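import Literature.Analysis.FluidPDE.TypeIAncientMild
import Literature.Analysis.FluidPDE.ClassicalSolution
import Literature.Analysis.FluidPDE.OseenMildPressureIdentification
import Literature.Analysis.FluidPDE.GigaMiura2011ScaledAlignmentBlowupLimitHolds
import Literature.Analysis.FluidPDE.RieszPressureModConstLog
import Literature.Analysis.FluidPDE.TsaiLocalPressureSup
import Literature.Analysis.FluidPDE.MildBoundedAncientPressureBMO
import Literature.Analysis.Calculus.DifferenceQuotientHolder
import HarnessLib

/-!
# The pressure of a BOUNDED mild ancient solution grows at most logarithmically — hence is sublinear at infinity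

Analysis/FluidPDE proof file (all results proved, standard axioms).  This is the «general form» left as a TODO in
`Literature/Analysis/FluidPDE/MildBoundedAncientPressureBMO.lean` (`MildAncientPressureLogGrowth`, stated and discharged there for the
Type-I-in-time class): for a BOUNDED ancient solution of the Navier–Stokes system that is mild in the sense of
Koch–Nadirashvili–Seregin–Šverák (the Oseen–Duhamel formula between any two negative times — Seregin 2014, Def. 6.3 and the equivalence
with the KNSS definition, p. 109; Remark 6.4, p. 103: mildness is exactly what excludes the parasitic linear pressures `b′(t)·x` of the
accelerated frames) every classical pressure `P` satisfies, on every slice `t < 0`,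
`|P(t,x) − P(t,0)| ≤ K (1 + log (1 + |x|))` (`p ∈ L∞(BMO)` with `∇p` bounded, Seregin 2014 Def. 6.3 / Prop. 3.9 / Lemma 6.5), and is
therefore SUBLINEAR AT INFINITY: `∀ ε > 0, ∃ R, ∀ y, R ≤ |y| → |P(t,y)| ≤ ε |y|`.

* `exists_abs_pressure_sub_le_log_of_bounded_oseenMild` — the logarithmic growth (route = the discharge of `MildAncientPressureLogGrowth`
  with boundedness in place of Type-I decay: KNSS 2009 Prop. 4.1 / (4.10) on a window (`exists_norm_iteratedFDeriv_le_of_bounded_oseenMild`)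
  bounds `∇v`, `∇²v`, hence the quadratic source (`abs_pressureSource_le`); the classical pressure of a bounded Oseen-mild window is the
  Riesz pressure modulo a constant (`PressureNormalisation.pressure_eq_pressurePotentialMod_add_const_of_oseenMild`); the Riesz pressure of a
  bounded field with bounded source grows at most logarithmically (`exists_abs_pressurePotentialMod_sub_le_log`)).
* `BoundedMildAncientPressureLogGrowth` / `…_holds` — the named fact and its discharge.
* The sublinear-gauge corollary (`∀ ε > 0, ∃ R, ∀ y, R ≤ ‖y‖ → |P(t,y)| ≤ ε ‖y‖`, the W1 custodians' `IsSublinearAtInfinity (P t)`)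
  is in the companion file `BoundedMildAncientPressureSublinear.lean`.

USE (NavierStokesRegularity, W1 board, scope gap C′ `ScaleFreeFarFieldSublinear` of the HorizonTower line): the gauge hypothesis
«every slice pressure is sublinear at infinity» is AUTOMATIC for the inertial (KNSS-mild) members of the bounded ancient class; the
accelerated rest frames, which violate it, are exactly the non-mild (drifting) members.

## References

* G. Seregin, *Lecture Notes on Regularity Theory for the Navier–Stokes Equations*, World Scientific 2014, §6.2 Thm. 2.6 + Remarks 6.2–6.4
  (p. 102–103), §6.2 Lemma 6.5, §6.3 Def. 6.3 + Prop. 3.9 (p. 109–110). [Seregin2014]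
* G. Koch, N. Nadirashvili, G. Seregin, V. Šverák, Acta Math. 203 (2009) 83–105 = arXiv:0709.3599, §4 Prop. 4.1 with (4.10), p. 8.
  [KochNadirashviliSereginSverak2009]

WHAT THIS IS NOT: not a claim about NS regularity or about the Liouville conjecture; the drifting (non-mild) bounded ancient solutions are
outside the hypothesis.
-/

noncomputable section

open Set Function
open _root_.Topology

namespace Literature.Analysis.FluidPDE

/-- **Logarithmic growth of the pressure of a BOUNDED mild ancient solution** — the NAMED FACT (general form of
`MildAncientPressureLogGrowth`, Seregin 2014 Def. 6.3 / Prop. 3.9 / Lemma 6.5 for the KNSS-mild class): for every `v` bounded on `t < 0`,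
continuous on `t < 0`, satisfying the Oseen–Duhamel (mild) formula between all pairs of negative times and divergence-free, and every
classical pressure `P` of it on `t < 0`, at each time `t < 0` there is `K` with `|P(t,x) − P(t,0)| ≤ K (1 + log (1 + ‖x‖))` for all `x`.
[cite: Seregin2014, §6.3 Def. 6.3 + Prop. 3.9 (p. 109–110); Remark 6.4 (p. 103); §6.2 Lemma 6.5] -/
def BoundedMildAncientPressureLogGrowth : Prop :=
  ∀ (M : ℝ) (v : ℝ → EuclideanSpace ℝ (Fin 3) → EuclideanSpace ℝ (Fin 3)) (P : ℝ → EuclideanSpace ℝ (Fin 3) → ℝ),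
    (∀ t < 0, ∀ x, ‖v t x‖ ≤ M) →
    ContinuousOn (Function.uncurry v) (Set.Iio (0 : ℝ) ×ˢ Set.univ) →
    (∀ s t : ℝ, s < t → t < 0 → ∀ x, v t x =
      UnboundedOperators.heatExtension (v s) (t - s) x - oseenDuhamel 1 s v v t x) →
    (∀ t < 0, VectorCalculus.IsDivFree (v t)) →
    IsClassicalNSSolutionOn (Set.Iio 0) 1 0 v P →
    ∀ t < 0, ∃ K : ℝ, ∀ x : EuclideanSpace ℝ (Fin 3), |P t x - P t 0| ≤ K * (1 + Real.log (1 + ‖x‖))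

/-! ### Discharge -/

section BoundedMildPressure

open MeasureTheory Metric Filter

-- nested operator types (`fderiv ℝ (fderiv ℝ v) x`)
set_option maxSynthPendingDepth 3

/-- Window bounds for all derivatives of a BOUNDED Oseen-mild ancient profile near a slice `t < 0`: on `(9t/8, 7t/8) ∋ t` one has
`‖∇ᵏv(σ,·)‖ ≤ K` — KNSS 2009 Prop. 4.1 / (4.10) (`exists_norm_iteratedFDeriv_le_of_bounded_oseenMild`) applied on the window
`A = 2t < a = 5t/4`, `[a + δ, a + ℓ) = [9t/8, 7t/8)` (no time shift is needed in the bounded class).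
[cite: KochNadirashviliSereginSverak2009, §4 Prop. 4.1 with (4.10) (arXiv:0709.3599 p. 8)] -/
theorem exists_window_iteratedFDeriv_le_of_bounded_oseenMild {M : ℝ}
    {v : ℝ → EuclideanSpace ℝ (Fin 3) → EuclideanSpace ℝ (Fin 3)}
    (hbd : ∀ t < 0, ∀ x, ‖v t x‖ ≤ M)
    (hcont : ContinuousOn (Function.uncurry v) (Set.Iio (0 : ℝ) ×ˢ Set.univ))
    (hmild : ∀ s t : ℝ, s < t → t < 0 → ∀ x, v t x =
      UnboundedOperators.heatExtension (v s) (t - s) x - oseenDuhamel 1 s v v t x)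
    (hwdiv : ∀ t < 0, IsWeaklyDivFree (v t)) {t : ℝ} (ht : t < 0) (k : ℕ) :
    ∃ K : ℝ, ∀ σ ∈ Ioo (9 * t / 8) (7 * t / 8), ∀ x, ‖iteratedFDeriv ℝ k (v σ) x‖ ≤ K := by
  obtain ⟨K, hK⟩ := exists_norm_iteratedFDeriv_le_of_bounded_oseenMild M k (ℓ := -(3 * t) / 8)
    (δ := -t / 8) (by linarith) (by linarith)
  have hsub : Ioo (2 * t) 0 ⊆ Set.Iio (0 : ℝ) := fun σ hσ => hσ.2
  have hc : ContinuousOn (Function.uncurry v) (Ioo (2 * t) 0 ×ˢ univ) :=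
    hcont.mono (prod_mono hsub subset_rfl)
  have hdiv : ∀ τ ∈ Ioo (2 * t) 0, IsWeaklyDivFree (v τ) := fun τ hτ => hwdiv τ hτ.2
  have hm : ∀ s t' : ℝ, 2 * t < s → s < t' → t' < 0 → ∀ x,
      v t' x = UnboundedOperators.heatExtension (v s) (t' - s) x - oseenDuhamel 1 s v v t' x :=
    fun s t' _ hst ht' x => hmild s t' hst ht' x
  have hb : ∀ τ ∈ Ioo (2 * t) 0, ∀ x, ‖v τ x‖ ≤ M := fun τ hτ x => hbd τ hτ.2 x
  have hwin := hK (A := 2 * t) (a := 5 * t / 4) (u := v) (by linarith) (by linarith) hc hdiv hm hb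
  refine ⟨K, fun σ hσ x => hwin σ ?_ x⟩
  constructor <;> [have := hσ.1; have := hσ.2] <;> linarith

/-- **Logarithmic growth of the pressure of a BOUNDED mild ancient solution** (Seregin 2014, Def. 6.3 with Remark 6.4 and Lemma 6.5;
KNSS 2009, §4): for `v` bounded on `t < 0`, continuous, Oseen-mild between all pairs of negative times and divergence-free, and ANY
classical pressure `P` of `v` on `t < 0`, at each `t < 0` there is `K` with `|P(t,x) − P(t,0)| ≤ K (1 + log (1 + ‖x‖))` for all `x`.
Proof = the discharge of `MildAncientPressureLogGrowth` with the bound `M` on the window `(9t/8, 7t/8)`.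
[cite: Seregin2014, §6.3 Def. 6.3 + Remark 6.4 (p. 103, 109); §6.2 Lemma 6.5] -/
theorem exists_abs_pressure_sub_le_log_of_bounded_oseenMild (M : ℝ)
    (v : ℝ → EuclideanSpace ℝ (Fin 3) → EuclideanSpace ℝ (Fin 3)) (P : ℝ → EuclideanSpace ℝ (Fin 3) → ℝ)
    (hbd : ∀ t < 0, ∀ x, ‖v t x‖ ≤ M)
    (hcont : ContinuousOn (Function.uncurry v) (Set.Iio (0 : ℝ) ×ˢ Set.univ))
    (hmild : ∀ s t : ℝ, s < t → t < 0 → ∀ x, v t x =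
      UnboundedOperators.heatExtension (v s) (t - s) x - oseenDuhamel 1 s v v t x)
    (hdiv : ∀ t < 0, VectorCalculus.IsDivFree (v t))
    (hcl : IsClassicalNSSolutionOn (Set.Iio 0) 1 0 v P) :
    ∀ t < 0, ∃ K : ℝ, ∀ x : EuclideanSpace ℝ (Fin 3), |P t x - P t 0| ≤ K * (1 + Real.log (1 + ‖x‖)) := by
  intro t ht
  have hM0 : 0 ≤ M := (norm_nonneg _).trans (hbd (-1) (by norm_num) 0)
  -- slices are smooth and (weakly) divergence free
  have hsm := fun (τ : ℝ) (hτ : τ < 0) => hcl.contDiff_velocity (t := τ) hτ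
  have hwdiv : ∀ τ < 0, IsWeaklyDivFree (v τ) := fun τ hτ =>
    VectorCalculus.IsDivFree.isWeaklyDivFree_holds (hdiv τ hτ) (contDiff_infty.1 (hsm τ hτ) 1)
  -- the window `(t₁, t₂) = (9t/8, 7t/8) ∋ t`
  set t₁ : ℝ := 9 * t / 8 with ht₁
  set t₂ : ℝ := 7 * t / 8 with ht₂
  have ht₂0 : t₂ < 0 := by rw [ht₂]; linarith
  have htI : t ∈ Ioo t₁ t₂ := by rw [ht₁, ht₂]; constructor <;> linarith
  have hIsub : Ioo t₁ t₂ ⊆ Set.Iio (0 : ℝ) := fun σ hσ => hσ.2.trans ht₂0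
  -- velocity bound on the window
  have hNb : ∀ σ ∈ Ioo t₁ t₂, ∀ x, ‖v σ x‖ ≤ M := fun σ hσ x => hbd σ (hIsub hσ) x
  -- derivative bounds on the window (KNSS Prop. 4.1)
  obtain ⟨K₁, hK₁⟩ := exists_window_iteratedFDeriv_le_of_bounded_oseenMild hbd hcont hmild hwdiv ht 1
  obtain ⟨K₂, hK₂⟩ := exists_window_iteratedFDeriv_le_of_bounded_oseenMild hbd hcont hmild hwdiv ht 2
  have hK₁0 : 0 ≤ K₁ := (norm_nonneg _).trans (hK₁ t htI 0)
  have hK₂0 : 0 ≤ K₂ := (norm_nonneg _).trans (hK₂ t htI 0)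
  -- the quadratic source is bounded on the window
  set T : ℝ := ‖(traceCLM : (EuclideanSpace ℝ (Fin 3) →L[ℝ] EuclideanSpace ℝ (Fin 3)) →L[ℝ] ℝ)‖ with hT
  have hT0 : 0 ≤ T := by rw [hT]; exact norm_nonneg _
  set NG : ℝ := 2 * T * K₂ * M + (T + T ^ 2) * K₁ ^ 2 with hNG
  have hNG0 : 0 ≤ NG := by rw [hNG]; positivity
  have hG : ∀ σ ∈ Ioo t₁ t₂, ∀ x, |pressureSource (v σ) x| ≤ NG := by
    intro σ hσ x
    have hσ0 : σ < 0 := hIsub hσ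
    have hcd : ContDiff ℝ 2 (v σ) := contDiff_infty.1 (hsm σ hσ0) 2
    have h := abs_pressureSource_le hcd x
    have hD1 : ‖fderiv ℝ (v σ) x‖ ≤ K₁ := by
      rw [← norm_iteratedFDeriv_one]; exact hK₁ σ hσ x
    have hD2 : ‖fderiv ℝ (fderiv ℝ (v σ)) x‖ ≤ K₂ :=
      (Literature.Analysis.Calculus.norm_fderiv_fderiv_le_norm_iteratedFDeriv_two (v σ) x).trans (hK₂ σ hσ x)
    have hv := hNb σ hσ x
    have A1 : 2 * T * ‖fderiv ℝ (fderiv ℝ (v σ)) x‖ * ‖v σ x‖ ≤ 2 * T * K₂ * M := by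
      have h1 : 2 * T * ‖fderiv ℝ (fderiv ℝ (v σ)) x‖ ≤ 2 * T * K₂ :=
        mul_le_mul_of_nonneg_left hD2 (by positivity)
      exact mul_le_mul h1 hv (norm_nonneg _) (by positivity)
    have A2 : (T + T ^ 2) * ‖fderiv ℝ (v σ) x‖ ^ 2 ≤ (T + T ^ 2) * K₁ ^ 2 :=
      mul_le_mul_of_nonneg_left (pow_le_pow_left₀ (norm_nonneg _) hD1 2) (by positivity)
    rw [hNG]
    exact h.trans (add_le_add A1 A2)
  -- Oseen-mild on the window; classical on the window
  have hmildW : ∀ s ∈ Ioo t₁ t₂, ∀ t' ∈ Ioo t₁ t₂, s < t' → ∀ x,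
      v t' x = UnboundedOperators.heatExtension (v s) (t' - s) x - oseenDuhamel 1 s v v t' x :=
    fun s _ t' ht' hst x => hmild s t' hst (hIsub ht') x
  have hclW : IsClassicalNSSolutionOn (Ioo t₁ t₂) 1 0 v P := hcl.mono hIsub (uniqueDiffOn_Ioo t₁ t₂)
  -- the pressure is the Riesz pressure modulo a constant
  obtain ⟨c, hc⟩ := PressureNormalisation.pressure_eq_pressurePotentialMod_add_const_of_oseenMild hclW hNb hG
    hmildW 0 htI
  -- logarithmic growth of the Riesz pressure modulo constants
  obtain ⟨A, hA0, hA⟩ := exists_abs_pressurePotentialMod_sub_le_log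
  set I : ℝ := ∫ z, |newtonNear 1 2 z| with hI
  have hI0 : 0 ≤ I := by rw [hI]; exact integral_nonneg fun z => abs_nonneg _
  have hcontv : Continuous (v t) := (hsm t ht).continuous
  refine ⟨2 * NG * I + A * M ^ 2, fun x => ?_⟩
  have hL0 : 0 ≤ Real.log (1 + ‖x‖) := Real.log_nonneg (by linarith [norm_nonneg x])
  have key := hA (v t) hcontv M NG (fun y => hNb t htI y) (fun y => hG t htI y) 0 x 0
  rw [sub_zero] at key
  calc |P t x - P t 0|
      = |pressurePotentialMod 0 (v t) x - pressurePotentialMod 0 (v t) 0| := by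
        rw [hc x, hc 0]; ring_nf
    _ ≤ 2 * NG * I + A * M ^ 2 * (1 + Real.log (1 + ‖x‖)) := key
    _ ≤ (2 * NG * I + A * M ^ 2) * (1 + Real.log (1 + ‖x‖)) := by
        have h1 : 0 ≤ 2 * NG * I := by positivity
        nlinarith

/-- **Discharge of `BoundedMildAncientPressureLogGrowth`** (by `exists_abs_pressure_sub_le_log_of_bounded_oseenMild`).
[cite: Seregin2014, §6.3 Def. 6.3 + Remark 6.4 (p. 103, 109); §6.2 Lemma 6.5] -/
theorem BoundedMildAncientPressureLogGrowth_holds : BoundedMildAncientPressureLogGrowth :=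
  fun M v P hbd hcont hmild hdiv hcl => exists_abs_pressure_sub_le_log_of_bounded_oseenMild M v P hbd hcont hmild hdiv hcl

end BoundedMildPressure

end Literature.Analysis.FluidPDE

end
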